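import Literature.NumberTheory.Kottwitz1992.VirtualAbelianVarieties
import Literature.AlgebraicGeometry.Motives.AbelianVarietyTorsionCubeProofs
import Literature.AlgebraicGeometry.Motives.AbelianVarietyDimZeroProofs
import Literature.NumberTheory.DiophantineGeometry.AVIsogenyTateFreeHomProofs
import Mathlib.FieldTheory.IsAlgClosed.Basic
import Mathlib.Analysis.Complex.Polynomial.Basic
import HarnessLib

/-!
# Discharge for the carpet `Kottwitz1992/VirtualAbelianVarieties` (§10): Corollary 10.5 («at most one `c`»)

`Kottwitz1992_10_5_c_unique_holds : VirtualAbelianVarieties.Kottwitz1992_10_5_c_unique` (ED. 1).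

Topic `Literature/NumberTheory/Kottwitz1992`; namespace `Literature.NumberTheory.Kottwitz1992.VirtualAbelianVarietiesHolds`.
The §10 carpet `VirtualAbelianVarieties` stays statements-only with its light import closure; the `_holds` of its closed
named fact Cor. 10.5 lives in this sibling proof-lane file (shape of ★ `Kottwitz1992/KottwitzTriplesHolds`, squad TK ruling
2026-09-02T02:29Z/02:30Z) because the proof imports the tree's PROVED structure theory of `End(Ā)` — `[n]_Ā` is an isogeny
(★ `Motives/AbelianVarietyTorsionCubeProofs`, theorem of the cube), hence `End(Ā)` is torsion-free and `End(Ā) → End⁰(Ā)` is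
injective (★ `DiophantineGeometry/AVIsogenyTateFreeHomProofs`), and `0 : Ā → Ā` is not an isogeny when `dim Ā > 0`
(★ `Motives/AbelianVarietyDimZeroProofs`) — which the §10 carpet should not inherit.  PROOFS ONLY: no definition, no new named
fact, no `sorry`, no `axiom`, no `instance`, no `notation` (net debt −1, D-0026).

Source, verbatim (R. E. Kottwitz, *Points on some Shimura varieties over finite fields*, JAMS **5** (1992), §10 p. 405 = held
`paper:doi-10-2307-2152772` p0033 L39–L43): «Corollary 10.5. Let `A` be a virtual abelian variety over `k_r` up to prime-to-`p`
isogeny. There is at most one value of `c` for which `A` is `c`-polarizable.  This is obvious, since `c` can be recovered by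
embedding `ℚ[π]` in `ℂ` and taking the square of the absolute value of `π`.»

## What is proved (all `theorem`s)

* §1 `nonempty_algHom_adjoin_singleton` (private helper) — for `π` in a NONTRIVIAL (possibly noncommutative) algebra `E` over a field `K` with
  `minpoly K π ≠ 0`, and `L ⊇ K` algebraically closed, there is a `K`-algebra homomorphism `K[π] → L` («embedding `ℚ[π]` in
  `ℂ`»: `K[π] ≅ K[X]/(minpoly)`, and the minimal polynomial, of positive degree since `E ≠ 0`, has a root in `L`).  Mathlib's
  `Algebra.adjoin.liftSingleton` / `AlgEquiv.adjoinSingletonEquivAdjoinRootMinpoly` assume a COMMUTATIVE ambient algebra, which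
  `End⁰(Ā)` is not; hence the ten-line construction through `Polynomial.aeval`.
* §2 `nontrivial_endAlgebra_of_dim_pos` — `End⁰(Ā) ≠ 0` for `dim Ā > 0` over ANY field (the tree proves this verbatim inside
  ★ `ComplexMultiplication/FieldOfDegreeTwoDimOnPowers` (`FieldOnPowers.nontrivial_endAlgebra_of_dim_pos`), whose CM import
  closure is not wanted here; re-derived from the three cited tree theorems in five lines).
* §3 `Kottwitz1992_10_5_c_unique_holds` — the printed proof: `A ∈ 𝒱_{r,c} ∩ 𝒱_{r,c'}` (`InVc`: `π_A` semisimple and every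
  `φ : ℚ[π_A] → ℂ` has `‖φ π_A‖² = c`, resp. `= c'`) and `dim Ā > 0` give one `φ`, and `c = ‖φ π_A‖² = c'`.

HC_CM is proved only modulo the 7 printed citations until rung 0 closes; this file bears on none of them.

## References
* [Kottwitz1992] R. E. Kottwitz, J. Amer. Math. Soc. 5 (1992), §10 Cor. 10.5 (p. 405).
* [MumfordAV1970] D. Mumford, *Abelian Varieties*, §19 Thm. 3 (`End(X)` torsion-free; through the tree theorems cited above).
-/

noncomputable section

open CategoryTheory Polynomial

namespace Literature.NumberTheory.Kottwitz1992.VirtualAbelianVarietiesHolds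

open Literature.AlgebraicGeometry.Motives Literature.AlgebraicGeometry.Motives.AbelianVariety
open Literature.NumberTheory.Kottwitz1992.VirtualAbelianVarieties VirtualAbelianVariety

universe u

/-! ## §1 «embedding `ℚ[π]` in `ℂ`» for `π` in a noncommutative algebra -/

section Embedding

variable {K : Type*} [Field K] {E : Type*} [Ring E] [Algebra K E] (L : Type*) [Field L] [Algebra K L] [IsAlgClosed L]

/-- For `π` in a nontrivial `K`-algebra `E` (not necessarily commutative) whose minimal polynomial over the field `K` is
nonzero (e.g. separable), and `L ⊇ K` algebraically closed, there is a `K`-algebra homomorphism `K[π] → L`: the minimal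
polynomial has positive degree, hence a root `z ∈ L`, and `X ↦ z` factors through `K[X] ↠ K[π]`, whose kernel is generated
by the minimal polynomial. [folklore] -/
private theorem nonempty_algHom_adjoin_singleton [Nontrivial E] (π : E) (hπ : minpoly K π ≠ 0) :
    Nonempty (Algebra.adjoin K {π} →ₐ[K] L) := by
  have hint : IsIntegral K π := by
    by_contra h
    exact hπ (minpoly.eq_zero h)
  -- a root of the minimal polynomial in `L`
  obtain ⟨z, hz⟩ := IsAlgClosed.exists_aeval_eq_zero L (minpoly K π) (minpoly.degree_pos hint).ne'
  -- `K[X] ↠ K[π]` and its kernel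
  set θ : K[X] →ₐ[K] (Polynomial.aeval π : K[X] →ₐ[K] E).range := (Polynomial.aeval π).rangeRestrict with hθ
  have hθs : Function.Surjective θ := (Polynomial.aeval π).rangeRestrict_surjective
  have hker : ∀ q ∈ RingHom.ker θ, Polynomial.aeval z q = 0 := by
    intro q hq
    have hq' : Polynomial.aeval π q = 0 := by
      have := congrArg Subtype.val (RingHom.mem_ker.1 hq)
      simpa [hθ] using this
    obtain ⟨s, hs⟩ := minpoly.dvd K π hq'
    rw [hs, map_mul, hz, zero_mul]
  -- assemble: `K[π] = range (aeval π) ≅ K[X]/ker θ → L`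
  let ψ : (K[X] ⧸ RingHom.ker θ) →ₐ[K] L := Ideal.Quotient.liftₐ (RingHom.ker θ) (Polynomial.aeval z) hker
  let e : (K[X] ⧸ RingHom.ker θ) ≃ₐ[K] (Polynomial.aeval π : K[X] →ₐ[K] E).range :=
    Ideal.quotientKerAlgEquivOfSurjective hθs
  let ι : Algebra.adjoin K {π} →ₐ[K] (Polynomial.aeval π : K[X] →ₐ[K] E).range :=
    (Subalgebra.equivOfEq _ _ (Algebra.adjoin_singleton_eq_range_aeval K π)).toAlgHom
  exact ⟨(ψ.comp e.symm.toAlgHom).comp ι⟩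

end Embedding

/-! ## §2 `End⁰(Ā) ≠ 0` for `dim Ā > 0`, over any field -/

/-- `End⁰(A) = ℚ ⊗ End(A)` of an abelian variety of positive dimension is a nontrivial ring: `𝟙_A ≠ 0` (the zero map is not
an isogeny, ★ `not_isIsogeny_zero_of_dim_pos`) and `End(A) → End⁰(A)` is injective (★ `endAlgebra.of_injective_of_isIsogeny_zsmul_id`
with ★ `isIsogeny_zsmul_id_holds`: `End(A)` is torsion-free, Mumford §19 Thm. 3).  (Same five lines as the tree's
`FieldOnPowers.nontrivial_endAlgebra_of_dim_pos`, not imported for its closure.) [cite: MumfordAV1970, §19 Thm. 3] -/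
theorem nontrivial_endAlgebra_of_dim_pos {k : Type u} [Field k] {A : AbelianVariety k} (hA : 0 < A.dim) :
    Nontrivial A.endAlgebra := by
  refine ⟨⟨0, 1, fun h01 => not_isIsogeny_zero_of_dim_pos (X := A) hA ?_⟩⟩
  have inj := endAlgebra.of_injective_of_isIsogeny_zsmul_id (isIsogeny_zsmul_id_holds A)
  have h : endAlgebra.of A 1 = endAlgebra.of A 0 := by rw [map_zero, map_one, h01]
  have h10 : (𝟙 A : A ⟶ A) = 0 := inj h
  simpa [h10] using isIsogeny_id A

/-! ## §3 Corollary 10.5 -/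

/-- **Discharge of `Kottwitz1992_10_5_c_unique`** [Kottwitz1992, Cor. 10.5 (p. 405)]: «There is at most one value of `c`
for which `A` is `c`-polarizable. This is obvious, since `c` can be recovered by embedding `ℚ[π]` in `ℂ` and taking the
square of the absolute value of `π`.»  As typed (`InVc`): `dim Ā > 0` makes `End⁰(Ā)` nontrivial (§2), the semisimple `π_A`
has a nonzero minimal polynomial, so some `φ : ℚ[π_A] →ₐ ℂ` exists (§1) and `c = ‖φ π_A‖² = c'`.
[cite: Kottwitz1992, Corollary 10.5 (p. 405)] -/
theorem Kottwitz1992_10_5_c_unique_holds : Kottwitz1992_10_5_c_unique := by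
  intro k _ _ p _ _ _ _ r _ X c c' hdim hc hc'
  haveI : Nontrivial X.A.endAlgebra := nontrivial_endAlgebra_of_dim_pos hdim
  obtain ⟨φ⟩ := nonempty_algHom_adjoin_singleton ℂ X.frob hc.1.ne_zero
  have h : ((c : ℝ) : ℝ) = (c' : ℝ) := (hc.2 φ).symm.trans (hc'.2 φ)
  exact_mod_cast h

end Literature.NumberTheory.Kottwitz1992.VirtualAbelianVarietiesHolds
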